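import Summits.QuantumFields.BalabanUV.T4Continuum.Support.NE3HessBounds

/-!
# T⁴ programme, node NE3 — CONTINUITY OF THE MIXED WILSON HESSIAN IN THE BOND-ℓ² NORM:
# `|hess V X Y W| ≤ 12·√(Σ_p bondSq X p)·√(Σ_p bondSq Y p)` for unitary `V`

First generation of the NE3 prover lineage P3 of the cell `pub-balaban` (unit `b2b-balaban-t4-ne3-p3`; co-owner #3 of
`BINDER-OWNERS.md` row NE3), third file of the `Support/NE3Hess*` family (P2∕P3 shared-file agreement, CLAIMS.log
l.5380 ∕ l.5549–5550).  Skeleton `HOME/t4/skeletons/NE3-t4-ne3-p3.md` leaf L6 (a) = road P2's leaf L6 (a)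
(`t4/skeletons/NE3-t4-ne3-p2.md`): the Λ-continuity of the second variation, here with the explicit constant `12` in
the `dirSq`-type currency `Σ_{p∈W} Σ_{b⊂∂p} ‖X(b)‖²` (which the energy norm dominates).

WHAT IS PROVED ([folklore]; unitary `V`, arbitrary directions `X`, `Y`): `bondL1At`∕`bondL1` (four-bond ℓ¹ sum) with
`bondL1At_sq_le` (≤ 4·bondSqAt); `norm_dcurlAt_le`: `‖dcurlAt V X Y p′‖ ≤ 2·bondL1 X·bondL1 Y`;
`abs_hessPlaqAt_le`: `|hessPlaqAt V X Y p′| ≤ 3·bondL1 X·bondL1 Y` (the plaquette variable has operator norm one: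
`CStarRing.norm_mul_mem_unitary`); **`abs_hess_le`** by Cauchy–Schwarz over the window.

HONEST FRAMING.  Finite-T⁴ ultraviolet bookkeeping (rung (B)+1); elementary inequalities; NOTHING is asserted about
Bałaban's minimisers or NE3; no conditional of the cell (`BetaPertH`, (B), (B^μ)) is used or hidden; NOT infinite
volume, NOT a mass gap, NOT Clay, NOT summit progress.  ABSOLUTE RULE kept.  PLACEMENT: our lemmas under
`Summits/QuantumFields/BalabanUV/`; imports `Support.NE3HessBounds` (this unit) only; moves nothing.
-/

set_option autoImplicit false

open scoped BigOperators Matrix Matrix.Norms.L2Operator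
open NormedSpace Finset

namespace Summit.QuantumFields.BalabanUV.T4Continuum.NE3HessContinuity

open Literature.MathematicalPhysics.QuantumFieldTheory.Balaban1983to89
open B7Prop1Explicit B7Prop2Explicit MatrixLog UnitaryModel MatrixNorms
open T4AveragingDeficitWall hiding Site Plane Plaq Bond
open AveragingDeficitTransport (norm_Ad_of_unitary)
open NE3HessForm NE3HessBounds

noncomputable section

variable {d : ℕ} {n : Type*} [Fintype n] [DecidableEq n]

/-! ## §1 Bond sums, the bilinear bound of the curl derivative, and the continuity of the Hessian -/

/-- The four-bond `ℓ¹` sum `Σ_{b⊂∂p′} ‖X(b)‖`. [folklore] -/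
def bondL1At (X : Site d → Fin d → Matrix n n ℂ) (z : Site d) (μ ν : Fin d) : ℝ :=
  ‖X z μ‖ + ‖X (z + e μ) ν‖ + ‖X (z + e ν) μ‖ + ‖X z ν‖

/-- `bondL1At` on indexed plaquettes. [folklore] -/
def bondL1 (X : Site d → Fin d → Matrix n n ℂ) (p : T4AveragingDeficitWall.Plaq d) : ℝ := bondL1At X p.1 p.2.1.1 p.2.1.2

/-- `bondL1At ≥ 0`. [folklore] -/
theorem bondL1At_nonneg (X : Site d → Fin d → Matrix n n ℂ) (z : Site d) (μ ν : Fin d) : 0 ≤ bondL1At X z μ ν := by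
  unfold bondL1At; positivity

/-- `(Σ_{b⊂∂p′}‖X(b)‖)² ≤ 4·Σ_{b⊂∂p′}‖X(b)‖²`. [folklore] -/
theorem bondL1At_sq_le (X : Site d → Fin d → Matrix n n ℂ) (z : Site d) (μ ν : Fin d) :
    bondL1At X z μ ν ^ 2 ≤ 4 * bondSqAt X z μ ν := by
  unfold bondL1At bondSqAt
  nlinarith [sq_nonneg (‖X z μ‖ - ‖X (z + e μ) ν‖), sq_nonneg (‖X z μ‖ - ‖X (z + e ν) μ‖),
    sq_nonneg (‖X z μ‖ - ‖X z ν‖), sq_nonneg (‖X (z + e μ) ν‖ - ‖X (z + e ν) μ‖),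
    sq_nonneg (‖X (z + e μ) ν‖ - ‖X z ν‖), sq_nonneg (‖X (z + e ν) μ‖ - ‖X z ν‖)]

/-- **`‖dcurlAt V X Y p′‖ ≤ 2·(Σ_{b⊂∂p′}‖X(b)‖)·(Σ_{b⊂∂p′}‖Y(b)‖)`** for unitary `V`. [folklore] -/
theorem norm_dcurlAt_le {V : Site d → Fin d → (Matrix n n ℂ)ˣ} (hV : IsUnitaryCfg V) (X Y : Site d → Fin d → Matrix n n ℂ)
    (z : Site d) (μ ν : Fin d) : ‖dcurlAt V X Y z μ ν‖ ≤ 2 * (bondL1At X z μ ν * bondL1At Y z μ ν) := by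
  have hu1 : V z μ ∈ unitaryUnits (Matrix n n ℂ) := hV z μ
  have hu2 : V (z + e μ) ν ∈ unitaryUnits (Matrix n n ℂ) := hV (z + e μ) ν
  have hu3i : (V (z + e ν) μ)⁻¹ ∈ unitaryUnits (Matrix n n ℂ) := (unitaryUnits (Matrix n n ℂ)).inv_mem (hV (z + e ν) μ)
  have hu12 : V z μ * V (z + e μ) ν ∈ unitaryUnits (Matrix n n ℂ) := (unitaryUnits (Matrix n n ℂ)).mul_mem hu1 hu2
  have hu23 : V (z + e μ) ν * (V (z + e ν) μ)⁻¹ ∈ unitaryUnits (Matrix n n ℂ) := (unitaryUnits (Matrix n n ℂ)).mul_mem hu2 hu3i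
  have hx1 : 0 ≤ ‖X z μ‖ := norm_nonneg _
  have hx2 : 0 ≤ ‖X (z + e μ) ν‖ := norm_nonneg _
  have hx3 : 0 ≤ ‖X (z + e ν) μ‖ := norm_nonneg _
  have hy4 : 0 ≤ ‖Y z ν‖ := norm_nonneg _
  have hy1 : 0 ≤ ‖Y z μ‖ := norm_nonneg _
  have hy2 : 0 ≤ ‖Y (z + e μ) ν‖ := norm_nonneg _
  have hy3 : 0 ≤ ‖Y (z + e ν) μ‖ := norm_nonneg _
  have hx4 : 0 ≤ ‖X z ν‖ := norm_nonneg _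
  have t1 : ‖Ad (V z μ) (X z μ * Y z μ - Y z μ * X z μ)‖ ≤ 2 * (‖X z μ‖ * ‖Y z μ‖) := by
    rw [norm_Ad_of_unitary hu1]; exact norm_comm_le _ _
  have t2a : ‖Ad (V z μ) (X z μ * Ad (V (z + e μ) ν) (Y (z + e μ) ν)
      - Ad (V (z + e μ) ν) (Y (z + e μ) ν) * X z μ)‖ ≤ 2 * (‖X z μ‖ * ‖Y (z + e μ) ν‖) := by
    rw [norm_Ad_of_unitary hu1, ← norm_Ad_of_unitary hu2 (Y (z + e μ) ν)]
    exact norm_comm_le _ _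
  have t2b : ‖Ad (V z μ * V (z + e μ) ν) (X (z + e μ) ν * Y (z + e μ) ν - Y (z + e μ) ν * X (z + e μ) ν)‖
      ≤ 2 * (‖X (z + e μ) ν‖ * ‖Y (z + e μ) ν‖) := by
    rw [norm_Ad_of_unitary hu12]; exact norm_comm_le _ _
  have t3a : ‖Ad (V z μ) (X z μ * Ad (V (z + e μ) ν) (Y (z + e ν) μ)
      - Ad (V (z + e μ) ν) (Y (z + e ν) μ) * X z μ)‖ ≤ 2 * (‖X z μ‖ * ‖Y (z + e ν) μ‖) := by
    rw [norm_Ad_of_unitary hu1, ← norm_Ad_of_unitary hu2 (Y (z + e ν) μ)]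
    exact norm_comm_le _ _
  have t3b : ‖Ad (V z μ * V (z + e μ) ν) (X (z + e μ) ν * Y (z + e ν) μ - Y (z + e ν) μ * X (z + e μ) ν)‖
      ≤ 2 * (‖X (z + e μ) ν‖ * ‖Y (z + e ν) μ‖) := by
    rw [norm_Ad_of_unitary hu12]; exact norm_comm_le _ _
  have t4a : ‖Ad (V z μ) (X z μ * Ad (V (z + e μ) ν * (V (z + e ν) μ)⁻¹) (Y z ν)
      - Ad (V (z + e μ) ν * (V (z + e ν) μ)⁻¹) (Y z ν) * X z μ)‖ ≤ 2 * (‖X z μ‖ * ‖Y z ν‖) := by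
    rw [norm_Ad_of_unitary hu1, ← norm_Ad_of_unitary hu23 (Y z ν)]
    exact norm_comm_le _ _
  have t4b : ‖Ad (V z μ * V (z + e μ) ν) ((X (z + e μ) ν - X (z + e ν) μ) * Ad (V (z + e ν) μ)⁻¹ (Y z ν)
      - Ad (V (z + e ν) μ)⁻¹ (Y z ν) * (X (z + e μ) ν - X (z + e ν) μ))‖
      ≤ 2 * ((‖X (z + e μ) ν‖ + ‖X (z + e ν) μ‖) * ‖Y z ν‖) := by
    rw [norm_Ad_of_unitary hu12]
    refine (norm_comm_le _ _).trans ?_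
    rw [norm_Ad_of_unitary hu3i]
    have h1 : ‖X (z + e μ) ν - X (z + e ν) μ‖ ≤ ‖X (z + e μ) ν‖ + ‖X (z + e ν) μ‖ := norm_sub_le _ _
    exact mul_le_mul_of_nonneg_left (mul_le_mul_of_nonneg_right h1 hy4) (by norm_num)
  have hsum : ‖dcurlAt V X Y z μ ν‖ ≤ 2 * (‖X z μ‖ * ‖Y z μ‖)
      + (2 * (‖X z μ‖ * ‖Y (z + e μ) ν‖) + 2 * (‖X (z + e μ) ν‖ * ‖Y (z + e μ) ν‖))
      + (2 * (‖X z μ‖ * ‖Y (z + e ν) μ‖) + 2 * (‖X (z + e μ) ν‖ * ‖Y (z + e ν) μ‖))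
      + (2 * (‖X z μ‖ * ‖Y z ν‖) + 2 * ((‖X (z + e μ) ν‖ + ‖X (z + e ν) μ‖) * ‖Y z ν‖)) := by
    unfold dcurlAt
    set T1 := Ad (V z μ) (X z μ * Y z μ - Y z μ * X z μ)
    set T2a := Ad (V z μ) (X z μ * Ad (V (z + e μ) ν) (Y (z + e μ) ν) - Ad (V (z + e μ) ν) (Y (z + e μ) ν) * X z μ)
    set T2b := Ad (V z μ * V (z + e μ) ν) (X (z + e μ) ν * Y (z + e μ) ν - Y (z + e μ) ν * X (z + e μ) ν)
    set T3a := Ad (V z μ) (X z μ * Ad (V (z + e μ) ν) (Y (z + e ν) μ) - Ad (V (z + e μ) ν) (Y (z + e ν) μ) * X z μ)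
    set T3b := Ad (V z μ * V (z + e μ) ν) (X (z + e μ) ν * Y (z + e ν) μ - Y (z + e ν) μ * X (z + e μ) ν)
    set T4a := Ad (V z μ) (X z μ * Ad (V (z + e μ) ν * (V (z + e ν) μ)⁻¹) (Y z ν)
        - Ad (V (z + e μ) ν * (V (z + e ν) μ)⁻¹) (Y z ν) * X z μ)
    set T4b := Ad (V z μ * V (z + e μ) ν) ((X (z + e μ) ν - X (z + e ν) μ) * Ad (V (z + e ν) μ)⁻¹ (Y z ν)
        - Ad (V (z + e ν) μ)⁻¹ (Y z ν) * (X (z + e μ) ν - X (z + e ν) μ))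
    have e1 : ‖T1 + (T2a + T2b) - (T3a + T3b) - (T4a + T4b)‖
        ≤ ‖T1 + (T2a + T2b) - (T3a + T3b)‖ + ‖T4a + T4b‖ := norm_sub_le _ _
    have e2 : ‖T1 + (T2a + T2b) - (T3a + T3b)‖ ≤ ‖T1 + (T2a + T2b)‖ + ‖T3a + T3b‖ := norm_sub_le _ _
    have e3 : ‖T1 + (T2a + T2b)‖ ≤ ‖T1‖ + ‖T2a + T2b‖ := norm_add_le _ _
    have e4 : ‖T2a + T2b‖ ≤ ‖T2a‖ + ‖T2b‖ := norm_add_le _ _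
    have e5 : ‖T3a + T3b‖ ≤ ‖T3a‖ + ‖T3b‖ := norm_add_le _ _
    have e6 : ‖T4a + T4b‖ ≤ ‖T4a‖ + ‖T4b‖ := norm_add_le _ _
    linarith
  refine hsum.trans ?_
  unfold bondL1At
  nlinarith [mul_nonneg hx1 hy1, mul_nonneg hx2 hy1, mul_nonneg hx3 hy1, mul_nonneg hx4 hy1,
    mul_nonneg hx2 hy2, mul_nonneg hx3 hy2, mul_nonneg hx4 hy2, mul_nonneg hx3 hy3, mul_nonneg hx4 hy3,
    mul_nonneg hx4 hy4, mul_nonneg hx1 hy4, mul_nonneg hx2 hy3]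

/-- **`|hessPlaqAt V X Y p′| ≤ 3·(Σ_{b⊂∂p′}‖X(b)‖)·(Σ_{b⊂∂p′}‖Y(b)‖)`** for unitary `V` (the plaquette variable has
operator norm one). [folklore] -/
theorem abs_hessPlaqAt_le [Nonempty n] {V : Site d → Fin d → (Matrix n n ℂ)ˣ} (hV : IsUnitaryCfg V) (X Y : Site d → Fin d → Matrix n n ℂ)
    (z : Site d) (μ ν : Fin d) : |hessPlaqAt V X Y z μ ν| ≤ 3 * (bondL1At X z μ ν * bondL1At Y z μ ν) := by
  have hU : ((hol V z (plaqWord μ ν) : (Matrix n n ℂ)ˣ) : Matrix n n ℂ) ∈ unitary (Matrix n n ℂ) := mem_unitaryUnits.mp (hol_mem_of hV _ _)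
  set M := dcurlAt V X Y z μ ν + curlAt V Y z μ ν * curlAt V X z μ ν
  have h1 : |hessPlaqAt V X Y z μ ν| ≤ ‖M‖ := by
    unfold hessPlaqAt
    rw [abs_neg]
    calc |nReTr (M * ((hol V z (plaqWord μ ν) : (Matrix n n ℂ)ˣ) : Matrix n n ℂ))|
        ≤ ‖M * ((hol V z (plaqWord μ ν) : (Matrix n n ℂ)ˣ) : Matrix n n ℂ)‖ := abs_nReTr_le_opNorm _
      _ = ‖M‖ := CStarRing.norm_mul_mem_unitary _ hU
  have h2 : ‖M‖ ≤ 2 * (bondL1At X z μ ν * bondL1At Y z μ ν) + bondL1At Y z μ ν * bondL1At X z μ ν := by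
    refine (norm_add_le _ _).trans (add_le_add (norm_dcurlAt_le hV X Y z μ ν) ?_)
    calc ‖curlAt V Y z μ ν * curlAt V X z μ ν‖ ≤ ‖curlAt V Y z μ ν‖ * ‖curlAt V X z μ ν‖ := opNorm_mul_le _ _
      _ ≤ bondL1At Y z μ ν * bondL1At X z μ ν :=
          mul_le_mul (norm_curlAt_le hV Y z μ ν) (norm_curlAt_le hV X z μ ν) (norm_nonneg _)
            (bondL1At_nonneg Y z μ ν)
  nlinarith [h1, h2]

/-- **CONTINUITY OF THE MIXED HESSIAN IN THE BOND-ℓ² NORM**: for unitary `V`,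
`|hess V X Y W| ≤ 12·√(Σ_{p∈W} bondSq X p)·√(Σ_{p∈W} bondSq Y p)` (Cauchy–Schwarz over the window; the continuity
constant Λ of skeleton leaf L6 (a) ∕ road P2's L6 (a), in the `dirSq`-type currency which the energy norm dominates).
[folklore] -/
theorem abs_hess_le [Nonempty n] {V : Site d → Fin d → (Matrix n n ℂ)ˣ} (hV : IsUnitaryCfg V) (X Y : Site d → Fin d → Matrix n n ℂ)
    (W : Finset (T4AveragingDeficitWall.Plaq d)) :
    |hess V X Y W| ≤ 12 * (Real.sqrt (∑ p ∈ W, bondSq X p) * Real.sqrt (∑ p ∈ W, bondSq Y p)) := by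
  have h1 : |hess V X Y W| ≤ ∑ p ∈ W, 3 * (bondL1 X p * bondL1 Y p) := by
    unfold hess
    refine (Finset.abs_sum_le_sum_abs _ _).trans (Finset.sum_le_sum fun p _ => ?_)
    exact abs_hessPlaqAt_le hV X Y p.1 p.2.1.1 p.2.1.2
  have hcs : (∑ p ∈ W, bondL1 X p * bondL1 Y p) ^ 2 ≤ (∑ p ∈ W, bondL1 X p ^ 2) * (∑ p ∈ W, bondL1 Y p ^ 2) :=
    Finset.sum_mul_sq_le_sq_mul_sq W (fun p => bondL1 X p) (fun p => bondL1 Y p)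
  have hX : ∑ p ∈ W, bondL1 X p ^ 2 ≤ 4 * ∑ p ∈ W, bondSq X p := by
    rw [Finset.mul_sum]; exact Finset.sum_le_sum fun p _ => bondL1At_sq_le X p.1 p.2.1.1 p.2.1.2
  have hY : ∑ p ∈ W, bondL1 Y p ^ 2 ≤ 4 * ∑ p ∈ W, bondSq Y p := by
    rw [Finset.mul_sum]; exact Finset.sum_le_sum fun p _ => bondL1At_sq_le Y p.1 p.2.1.1 p.2.1.2
  have hSX : 0 ≤ ∑ p ∈ W, bondSq X p := Finset.sum_nonneg fun p _ => by unfold bondSq bondSqAt; positivity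
  have hSY : 0 ≤ ∑ p ∈ W, bondSq Y p := Finset.sum_nonneg fun p _ => by unfold bondSq bondSqAt; positivity
  have hPX : 0 ≤ ∑ p ∈ W, bondL1 X p ^ 2 := Finset.sum_nonneg fun p _ => sq_nonneg _
  have hS0 : 0 ≤ ∑ p ∈ W, bondL1 X p * bondL1 Y p :=
    Finset.sum_nonneg fun p _ => mul_nonneg (bondL1At_nonneg X _ _ _) (bondL1At_nonneg Y _ _ _)
  have hsqrt4 : Real.sqrt 4 = 2 := by
    rw [show (4 : ℝ) = 2 ^ 2 by norm_num, Real.sqrt_sq (by norm_num)]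
  -- S ≤ √(P Q) = √P √Q ≤ √(4 ΣX) √(4 ΣY) = 4 √ΣX √ΣY
  have h3a : ∑ p ∈ W, bondL1 X p * bondL1 Y p
      ≤ Real.sqrt (∑ p ∈ W, bondL1 X p ^ 2) * Real.sqrt (∑ p ∈ W, bondL1 Y p ^ 2) := by
    rw [← Real.sqrt_mul hPX, ← Real.sqrt_sq hS0]
    exact Real.sqrt_le_sqrt hcs
  have h3b : Real.sqrt (∑ p ∈ W, bondL1 X p ^ 2) ≤ 2 * Real.sqrt (∑ p ∈ W, bondSq X p) := by
    rw [← hsqrt4, ← Real.sqrt_mul (by norm_num : (0:ℝ) ≤ 4)]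
    exact Real.sqrt_le_sqrt hX
  have h3c : Real.sqrt (∑ p ∈ W, bondL1 Y p ^ 2) ≤ 2 * Real.sqrt (∑ p ∈ W, bondSq Y p) := by
    rw [← hsqrt4, ← Real.sqrt_mul (by norm_num : (0:ℝ) ≤ 4)]
    exact Real.sqrt_le_sqrt hY
  have h3 : ∑ p ∈ W, bondL1 X p * bondL1 Y p
      ≤ 4 * (Real.sqrt (∑ p ∈ W, bondSq X p) * Real.sqrt (∑ p ∈ W, bondSq Y p)) := by
    have hm := mul_le_mul h3b h3c (Real.sqrt_nonneg _) (by positivity)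
    linarith
  have h4 : ∑ p ∈ W, 3 * (bondL1 X p * bondL1 Y p) = 3 * ∑ p ∈ W, bondL1 X p * bondL1 Y p := by
    rw [Finset.mul_sum]
  linarith [h1, h3, h4.le, h4.ge]

end

end Summit.QuantumFields.BalabanUV.T4Continuum.NE3HessContinuity
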